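import Literature.NumberTheory.GaloisRepresentations.LabelFilDTransport
import Literature.NumberTheory.GaloisRepresentations.PotentialDiagonalizabilityCriteriaProofs
import HarnessLib

/-!
# Labelled Hodge–Tate weights are additive over direct sums (block-diagonal representations)

Topic `NumberTheory/GaloisRepresentations`; theorems only (no definition, no named fact).

Fontaine's `D_B` commutes with finite direct sums *as a filtered module with coefficients*:
for `E`-linear representations `ρ₁, …, ρ_d` of `Γ` and the componentwise representation `ρ` on
`Π_k V_k`, and every label `τ : F → E` (`F = B^Γ`),

  `Fil^i D_τ(ρ) ≅ Π_k Fil^i D_τ(ρ_k)`   (`E`-linear),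

so `dim_E Fil^i D_τ(ρ) = Σ_k dim_E Fil^i D_τ(ρ_k)` (`finrank_labelFilD_pi`) and, the multiset of
jumps being additive over antitone dimension functions (`jumpMultiset_add`, `jumpMultiset_sum`),

  `HT_τ(ρ) = Σ_k HT_τ(ρ_k)`   (multiset sum; `labelledHodgeTateWeights_pi`),

as soon as the label components `D_τ(ρ_k)` are finite-dimensional.  The framed form
(`labelledHodgeTateWeights_blockDiagonal`): if `T : Γ →ₜ* GL_N(E)` is block diagonal along
`e : Fin d × Fin n ≃ Fin N`, `T(g) = e·diag(S₁(g), …, S_d(g))·e⁻¹` — the normal form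
`Matrix.reindex e e (Matrix.comp _ _ _ _ _ (Matrix.diagonal fun k => S k g))` shared by
`FramedGaloisRep.induce`, `PeriodRingData.isAdmissible_restrictScalars_blockDiagonal_iff` and
`FramedRep.IsDeRhamWith.block_of_blockDiagonal` — then `HT_τ(T) = Σ_k HT_τ(S_k)` for every
period-ring datum `𝔅` over `P` and every `τ`.  On the way: functoriality of `D_τ`, `Fil^i D_τ`
in the representation (`labelFilD_map_left`: an `E`-linear `Γ`-equivariant `f : V → V'` induces
`f ⊗ 1 : Fil^i D_τ(ρ) → Fil^i D_τ(ρ')`) and invariance of the labelled weights under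
`E`-linear `Γ`-equivariant isomorphisms (`labelledHodgeTateWeights_eq_of_equiv`; the framed
special case `labelledHodgeTateWeights_conj` is in `LabelledWeightsInvariance`).

This is the direct-sum companion of the accepted Kronecker-product file
`LabelledWeightsKronecker` (`HT_τ(r₁ ⊗ r₂)` = pairwise sums) and of `finrank_D_pi` /
`isAdmissible_pi_iff` (`PotentialDiagonalizabilityCriteriaProofs`, the unlabelled, unfiltered
count); it is the additivity step of Patrikis's Lemma 7.2.1 on `τ`-components
(`HT_τ(Ind W) = Σ HT_σ(W)`, named fact `PAdicHodge.LabelledWeightsInduceSchema`), where `Ind W`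
restricted to a Galois closure is block diagonal (`PAdicHodge/DeRhamInductionDescent`).

Sources: Fontaine, Astérisque 223, Exp. III §1.5, Prop. 1.5.2 (`D_B(V₁ ⊕ V₂) = D_B(V₁) ⊕ D_B(V₂)`,
with its filtration for `B = B_dR`, §1.5.4); Brinon–Conrad, CMI notes, Thm. 5.2.1 (exactness
properties of `D_B` on admissible objects) and §6.3; Patrikis, *Variations on a theorem of Tate*,
§2.3.1 (`HT_τ` of filtered `F ⊗ E`-modules; additivity in direct sums is used throughout §2.3–2.4).

## References

* [FontaineAsterisque223III] J.-M. Fontaine, *Représentations p-adiques semi-stables*,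
  Astérisque 223 (1994), Exp. III §1.5, Prop. 1.5.2.
* [BrinonConrad2009] O. Brinon, B. Conrad, *CMI Summer School notes on p-adic Hodge theory*
  (2009), Thm. 5.2.1, §6.3.
* [Patrikis2019] S. Patrikis, *Variations on a theorem of Tate*, Mem. AMS 258 (2019), §2.3.1.
-/

noncomputable section

open scoped TensorProduct
open TensorProduct

namespace Literature.NumberTheory.GaloisRepresentations

universe u v v' w

/-! ### §1 The multiset of jumps is additive over antitone dimension functions -/

section Jumps

/-- A bounded antitone `d : ℤ → ℕ` has finitely many jumps (`i ↦ d i` is injective on the jump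
set and takes values in `[0, B]`).  [cite: FontaineAsterisque223III, Exp. III §1.5.4] -/
theorem jumps_finite_of_antitone_of_le {d : ℤ → ℕ} (hd : Antitone d) {B : ℕ}
    (hB : ∀ i, d i ≤ B) : {i : ℤ | d (i + 1) < d i}.Finite := by
  refine Set.Finite.of_finite_image (f := d) ((Set.finite_Iic B).subset ?_) ?_
  · rintro _ ⟨i, -, rfl⟩
    exact hB i
  · intro i hi j hj hij
    have hi' : d (i + 1) < d i := hi
    have hj' : d (j + 1) < d j := hj
    by_contra hne
    rcases lt_or_gt_of_ne hne with h | h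
    · exact absurd hij (ne_of_gt (lt_of_le_of_lt (hd (show i + 1 ≤ j by omega)) hi'))
    · exact absurd hij.symm (ne_of_gt (lt_of_le_of_lt (hd (show j + 1 ≤ i by omega)) hj'))

/-- A jump of `d₁ + d₂` is a jump of `d₁` or of `d₂`. [cite: FontaineAsterisque223III, Exp. III §1.5.4] -/
theorem jumps_add_subset (d₁ d₂ : ℤ → ℕ) :
    {i : ℤ | (d₁ + d₂) (i + 1) < (d₁ + d₂) i} ⊆
      {i : ℤ | d₁ (i + 1) < d₁ i} ∪ {i : ℤ | d₂ (i + 1) < d₂ i} := by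
  intro i hi
  simp only [Set.mem_union, Set.mem_setOf_eq, Pi.add_apply] at hi ⊢
  by_contra h
  simp only [not_or, not_lt] at h
  omega

/-- **Additivity of the jump multiset**: for antitone `d₁, d₂ : ℤ → ℕ` with finitely many jumps,
`jumpMultiset (d₁ + d₂) = jumpMultiset d₁ + jumpMultiset d₂` (`dim gr^i` is additive).
[cite: FontaineAsterisque223III, Exp. III §1.5.4 and Prop. 1.5.2] -/
theorem jumpMultiset_add {d₁ d₂ : ℤ → ℕ} (h₁ : Antitone d₁) (h₂ : Antitone d₂)
    (hf₁ : {i : ℤ | d₁ (i + 1) < d₁ i}.Finite) (hf₂ : {i : ℤ | d₂ (i + 1) < d₂ i}.Finite) :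
    jumpMultiset (d₁ + d₂) = jumpMultiset d₁ + jumpMultiset d₂ := by
  have hf : {i : ℤ | (d₁ + d₂) (i + 1) < (d₁ + d₂) i}.Finite :=
    (hf₁.union hf₂).subset (jumps_add_subset d₁ d₂)
  ext i
  rw [Multiset.count_add, count_jumpMultiset hf, count_jumpMultiset hf₁, count_jumpMultiset hf₂]
  have e₁ : d₁ (i + 1) ≤ d₁ i := h₁ (by omega)
  have e₂ : d₂ (i + 1) ≤ d₂ i := h₂ (by omega)
  simp only [Pi.add_apply]
  omega

/-- A constant dimension function has no jumps. [cite: FontaineAsterisque223III, Exp. III §1.5.4] -/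
theorem jumpMultiset_const (c : ℕ) : jumpMultiset (fun _ : ℤ => c) = 0 := by
  have hf : {i : ℤ | (fun _ : ℤ => c) (i + 1) < (fun _ : ℤ => c) i}.Finite := by simp
  ext i
  rw [count_jumpMultiset hf, Multiset.count_zero, Nat.sub_self]

/-- A finite sum of dimension functions with finitely many jumps has finitely many jumps.
[cite: FontaineAsterisque223III, Exp. III §1.5.4] -/
theorem jumps_sum_finite {κ : Type*} (s : Finset κ) (d : κ → ℤ → ℕ)
    (hf : ∀ k ∈ s, {i : ℤ | d k (i + 1) < d k i}.Finite) :
    {i : ℤ | (∑ k ∈ s, d k (i + 1)) < ∑ k ∈ s, d k i}.Finite := by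
  classical
  induction s using Finset.induction_on with
  | empty => simp
  | insert a s ha ih =>
    simp only [Finset.sum_insert ha]
    refine ((hf a (Finset.mem_insert_self a s)).union
      (ih fun k hk => hf k (Finset.mem_insert_of_mem hk))).subset ?_
    intro i hi
    simp only [Set.mem_union, Set.mem_setOf_eq] at hi ⊢
    by_contra h
    simp only [not_or, not_lt] at h
    omega

/-- **The jump multiset of a finite sum of antitone dimension functions (with finitely many jumps)
is the sum of their jump multisets.** [cite: FontaineAsterisque223III, Exp. III §1.5.4 and Prop. 1.5.2] -/
theorem jumpMultiset_sum {κ : Type*} (s : Finset κ) (d : κ → ℤ → ℕ)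
    (h : ∀ k ∈ s, Antitone (d k)) (hf : ∀ k ∈ s, {i : ℤ | d k (i + 1) < d k i}.Finite) :
    jumpMultiset (fun i => ∑ k ∈ s, d k i) = ∑ k ∈ s, jumpMultiset (d k) := by
  classical
  induction s using Finset.induction_on with
  | empty => simpa using jumpMultiset_const 0
  | insert a s ha ih =>
    simp only [Finset.sum_insert ha]
    have hs : Antitone fun i => ∑ k ∈ s, d k i := fun i j hij =>
      Finset.sum_le_sum fun k hk => h k (Finset.mem_insert_of_mem hk) hij
    have hfs : {i : ℤ | (fun i => ∑ k ∈ s, d k i) (i + 1) < (fun i => ∑ k ∈ s, d k i) i}.Finite :=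
      jumps_sum_finite s d fun k hk => hf k (Finset.mem_insert_of_mem hk)
    rw [← ih (fun k hk => h k (Finset.mem_insert_of_mem hk))
      (fun k hk => hf k (Finset.mem_insert_of_mem hk)),
      ← jumpMultiset_add (h a (Finset.mem_insert_self a s)) hs (hf a (Finset.mem_insert_self a s))
        hfs]
    rfl

end Jumps

namespace PeriodRingData

-- Mathlib's own global value of `maxSynthPendingDepth` (the project default `1` makes nested
-- instance problems on `M ⊗[P] 𝔅.B` fail spuriously; see `LabelFilDTransport`).
set_option maxSynthPendingDepth 3

/-! ### §2 Functoriality of `D_τ`, `Fil^i D_τ` in the representation -/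

section MapLeft

variable {Γ : Type u} [Group Γ] [TopologicalSpace Γ] {P : Type v} {F : Type v'} [Field P]
  [Field F] [Algebra P F]
  {E : Type*} [Field E] [Algebra P E] [TopologicalSpace E]
  {M : Type*} [AddCommGroup M] [Module E M] [Module P M] [IsScalarTower P E M]
  [TopologicalSpace M]
  {M' : Type*} [AddCommGroup M'] [Module E M'] [Module P M'] [IsScalarTower P E M']
  [TopologicalSpace M']
  (𝔅 : PeriodRingData.{u, v, v', w} Γ P F) (ρ : ContinuousRep Γ E M) (ρ' : ContinuousRep Γ E M')

/-- `f ⊗ 1` intertwines the diagonal actions for a `Γ`-equivariant `E`-linear `f : V → V'`.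
[cite: FontaineAsterisque223III, Exp. III §1.5] -/
theorem coeffTensorRep_map_left (f : M →ₗ[E] M') (hf : ∀ (σ : Γ) (m : M), f (ρ σ m) = ρ' σ (f m))
    (σ : Γ) (x : M ⊗[P] 𝔅.B) :
    AlgebraTensorModule.map f LinearMap.id (𝔅.coeffTensorRep ρ σ x) =
      𝔅.coeffTensorRep ρ' σ (AlgebraTensorModule.map f LinearMap.id x) := by
  induction x using TensorProduct.induction_on with
  | zero => simp only [map_zero]
  | tmul m b => simp [hf]
  | add x y hx hy => simp only [map_add, hx, hy]

omit [TopologicalSpace Γ] [TopologicalSpace E] [TopologicalSpace M] [TopologicalSpace M'] in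
/-- `f ⊗ 1` commutes with the `F`-structure `baseAct`. [cite: Patrikis2019, §2.3.1] -/
theorem baseAct_map_left (f : M →ₗ[E] M') (a : F) (x : M ⊗[P] 𝔅.B) :
    AlgebraTensorModule.map f LinearMap.id (𝔅.baseAct E M a x) =
      𝔅.baseAct E M' a (AlgebraTensorModule.map f LinearMap.id x) := by
  induction x using TensorProduct.induction_on with
  | zero => simp only [map_zero]
  | tmul m b => simp
  | add x y hx hy => simp only [map_add, hx, hy]

omit [TopologicalSpace Γ] [TopologicalSpace E] [TopologicalSpace M] [TopologicalSpace M'] in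
/-- `f ⊗ 1` maps `V ⊗ Fil^i B` into `V' ⊗ Fil^i B`. [cite: FontaineAsterisque223III, Exp. III §1.5.4] -/
theorem coeffFilTensor_map_left (f : M →ₗ[E] M') {i : ℤ} {x : M ⊗[P] 𝔅.B}
    (hx : x ∈ 𝔅.coeffFilTensor E M i) :
    AlgebraTensorModule.map f LinearMap.id x ∈ 𝔅.coeffFilTensor E M' i := by
  refine 𝔅.coeffFilTensor_induction
    (C := fun x => AlgebraTensorModule.map f LinearMap.id x ∈ 𝔅.coeffFilTensor E M' i)
    (by simp) (fun m b hb => ?_) (fun x y hx hy => by simpa using add_mem hx hy) hx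
  rw [AlgebraTensorModule.map_tmul, LinearMap.id_apply]
  exact 𝔅.tmul_mem_coeffFilTensor _ hb

/-- `f ⊗ 1` maps `D(ρ)` into `D(ρ')`. [cite: FontaineAsterisque223III, Exp. III §1.5, Prop. 1.5.2] -/
theorem coeffD_map_left (f : M →ₗ[E] M') (hf : ∀ (σ : Γ) (m : M), f (ρ σ m) = ρ' σ (f m))
    {x : M ⊗[P] 𝔅.B} (hx : x ∈ 𝔅.coeffD ρ) :
    AlgebraTensorModule.map f LinearMap.id x ∈ 𝔅.coeffD ρ' :=
  (𝔅.mem_coeffD_iff ρ' _).2 fun σ => by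
    rw [← 𝔅.coeffTensorRep_map_left ρ ρ' f hf σ x, (𝔅.mem_coeffD_iff ρ x).1 hx σ]

/-- `f ⊗ 1` maps the label component `D_τ(ρ)` into `D_τ(ρ')`. [cite: Patrikis2019, §2.3.1] -/
theorem labelD_map_left (f : M →ₗ[E] M') (hf : ∀ (σ : Γ) (m : M), f (ρ σ m) = ρ' σ (f m))
    (τ : F →+* E) {x : M ⊗[P] 𝔅.B} (hx : x ∈ 𝔅.labelD ρ τ) :
    AlgebraTensorModule.map f LinearMap.id x ∈ 𝔅.labelD ρ' τ :=
  (𝔅.mem_labelD_iff ρ' τ _).2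
    ⟨𝔅.coeffD_map_left ρ ρ' f hf ((𝔅.mem_labelD_iff ρ τ x).1 hx).1, fun a => by
      rw [← 𝔅.baseAct_map_left, ((𝔅.mem_labelD_iff ρ τ x).1 hx).2 a, map_smul]⟩

/-- **Functoriality of `Fil^i D_τ`**: `f ⊗ 1` maps `Fil^i D_τ(ρ)` into `Fil^i D_τ(ρ')` for a
`Γ`-equivariant `E`-linear `f : V → V'`.
[cite: FontaineAsterisque223III, Exp. III §1.5.4 and Prop. 1.5.2] [cite: Patrikis2019, §2.3.1] -/
theorem labelFilD_map_left (f : M →ₗ[E] M') (hf : ∀ (σ : Γ) (m : M), f (ρ σ m) = ρ' σ (f m))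
    (τ : F →+* E) {i : ℤ} {x : M ⊗[P] 𝔅.B} (hx : x ∈ 𝔅.labelFilD ρ τ i) :
    AlgebraTensorModule.map f LinearMap.id x ∈ 𝔅.labelFilD ρ' τ i :=
  Submodule.mem_inf.2
    ⟨𝔅.labelD_map_left ρ ρ' f hf τ (Submodule.mem_inf.1 hx).1,
      𝔅.coeffFilTensor_map_left f (Submodule.mem_inf.1 hx).2⟩

/-- **`dim_E Fil^i D_τ` is invariant under `E`-linear `Γ`-equivariant isomorphisms `V ≃ V'`**
(`Φ ⊗ 1` and `Φ⁻¹ ⊗ 1` restrict to inverse isomorphisms of the filtration pieces).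
[cite: FontaineAsterisque223III, Exp. III §1.5, Prop. 1.5.2] [cite: Patrikis2019, §2.3.1] -/
theorem finrank_labelFilD_eq_of_equiv (Φ : M ≃ₗ[E] M')
    (hΦ : ∀ (σ : Γ) (m : M), Φ (ρ σ m) = ρ' σ (Φ m)) (τ : F →+* E) (i : ℤ) :
    Module.finrank E (𝔅.labelFilD ρ τ i) = Module.finrank E (𝔅.labelFilD ρ' τ i) := by
  have hΦ' : ∀ (σ : Γ) (m' : M'), Φ.symm (ρ' σ m') = ρ σ (Φ.symm m') := fun σ m' => by
    apply Φ.injective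
    rw [hΦ, Φ.apply_symm_apply, Φ.apply_symm_apply]
  have h1 : ∀ (σ : Γ) (m : M), Φ.toLinearMap (ρ σ m) = ρ' σ (Φ.toLinearMap m) := fun σ m => by
    simpa using hΦ σ m
  have h2 : ∀ (σ : Γ) (m' : M'), Φ.symm.toLinearMap (ρ' σ m') = ρ σ (Φ.symm.toLinearMap m') :=
    fun σ m' => by simpa using hΦ' σ m'
  let T : M ⊗[P] 𝔅.B →ₗ[E] M' ⊗[P] 𝔅.B := AlgebraTensorModule.map Φ.toLinearMap LinearMap.id
  let T' : M' ⊗[P] 𝔅.B →ₗ[E] M ⊗[P] 𝔅.B := AlgebraTensorModule.map Φ.symm.toLinearMap LinearMap.id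
  have hTT' : ∀ y, T (T' y) = y := fun y => by
    induction y using TensorProduct.induction_on with
    | zero => simp only [map_zero]
    | tmul m b => simp [T, T']
    | add x y hx hy => simp only [map_add, hx, hy]
  have hT'T : ∀ x, T' (T x) = x := fun x => by
    induction x using TensorProduct.induction_on with
    | zero => simp only [map_zero]
    | tmul m b => simp [T, T']
    | add x y hx hy => simp only [map_add, hx, hy]
  let e : 𝔅.labelFilD ρ τ i ≃ₗ[E] 𝔅.labelFilD ρ' τ i :=
    { toFun := fun x => ⟨T x, 𝔅.labelFilD_map_left ρ ρ' Φ.toLinearMap h1 τ x.2⟩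
      map_add' := fun x y => Subtype.ext (by simp)
      map_smul' := fun c x => Subtype.ext (by simp)
      invFun := fun y => ⟨T' y, 𝔅.labelFilD_map_left ρ' ρ Φ.symm.toLinearMap h2 τ y.2⟩
      left_inv := fun x => Subtype.ext (hT'T x)
      right_inv := fun y => Subtype.ext (hTT' y) }
  exact e.finrank_eq

/-- **Labelled Hodge–Tate weights are invariant under `E`-linear `Γ`-equivariant isomorphisms.**
[cite: FontaineAsterisque223III, Exp. III §1.5, Prop. 1.5.2] [cite: Patrikis2019, §2.3.1] -/
theorem labelledHodgeTateWeights_eq_of_equiv (Φ : M ≃ₗ[E] M')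
    (hΦ : ∀ (σ : Γ) (m : M), Φ (ρ σ m) = ρ' σ (Φ m)) (τ : F →+* E) :
    𝔅.labelledHodgeTateWeights ρ τ = 𝔅.labelledHodgeTateWeights ρ' τ := by
  rw [labelledHodgeTateWeights_def, labelledHodgeTateWeights_def]
  congr 1
  funext i
  exact 𝔅.finrank_labelFilD_eq_of_equiv ρ ρ' Φ hΦ τ i

end MapLeft

/-! ### §3 Direct sums: `Fil^i D_τ(Π ρ_k) ≅ Π_k Fil^i D_τ(ρ_k)` -/

section Pi

variable {Γ : Type u} [Group Γ] [TopologicalSpace Γ] {P : Type v} {F : Type v'} [Field P]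
  [Field F] [Algebra P F]
  {E : Type*} [Field E] [Algebra P E] [TopologicalSpace E]
  {ι : Type*} [Fintype ι] [DecidableEq ι]
  {N : ι → Type*} [∀ k, AddCommGroup (N k)] [∀ k, Module E (N k)] [∀ k, Module P (N k)]
  [∀ k, IsScalarTower P E (N k)] [∀ k, TopologicalSpace (N k)]
  (𝔅 : PeriodRingData.{u, v, v', w} Γ P F) (ρ : ContinuousRep Γ E (∀ k, N k))
  (ρs : ∀ k, ContinuousRep Γ E (N k))

/-- **`dim_E Fil^i D_τ(Π_k ρ_k) = Σ_k dim_E Fil^i D_τ(ρ_k)`** for a representation acting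
componentwise on `Π_k V_k` (the projections and inclusions `π_k ⊗ 1`, `ι_k ⊗ 1` split
`Fil^i D_τ` as `Π_k Fil^i D_τ(ρ_k)`), the label components `D_τ(ρ_k)` being finite-dimensional.
[cite: FontaineAsterisque223III, Exp. III §1.5.4 and Prop. 1.5.2] [cite: Patrikis2019, §2.3.1] -/
theorem finrank_labelFilD_pi (h : ∀ (σ : Γ) (x : ∀ k, N k) (k : ι), ρ σ x k = ρs k σ (x k))
    (τ : F →+* E) (i : ℤ) (hfin : ∀ k, FiniteDimensional E (𝔅.labelD (ρs k) τ)) :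
    Module.finrank E (𝔅.labelFilD ρ τ i) = ∑ k, Module.finrank E (𝔅.labelFilD (ρs k) τ i) := by
  haveI : ∀ k, FiniteDimensional E (𝔅.labelFilD (ρs k) τ i) := fun k =>
    Submodule.finiteDimensional_of_le (𝔅.labelFilD_le (ρs k) τ i)
  -- the projections `π_k ⊗ 1` and inclusions `ι_k ⊗ 1`
  let π : ∀ k, (∀ k, N k) ⊗[P] 𝔅.B →ₗ[E] N k ⊗[P] 𝔅.B := fun k =>
    AlgebraTensorModule.map (LinearMap.proj k : (∀ k, N k) →ₗ[E] N k) LinearMap.id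
  let ι' : ∀ k, N k ⊗[P] 𝔅.B →ₗ[E] (∀ k, N k) ⊗[P] 𝔅.B := fun k =>
    AlgebraTensorModule.map (LinearMap.single E N k) LinearMap.id
  have hπ : ∀ (k : ι) (σ : Γ) (x : ∀ k, N k),
      (LinearMap.proj k : (∀ k, N k) →ₗ[E] N k) (ρ σ x) = ρs k σ ((LinearMap.proj k : (∀ k, N k) →ₗ[E] N k) x) :=
    fun k σ x => h σ x k
  have hι : ∀ (k : ι) (σ : Γ) (m : N k),
      LinearMap.single E N k (ρs k σ m) = ρ σ (LinearMap.single E N k m) := by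
    intro k σ m
    funext j
    rw [h]
    rcases eq_or_ne j k with rfl | hjk
    · simp
    · simp [hjk]
  -- `Σ_k ι_k (π_k x) = x`
  have hsum : ∀ x : (∀ k, N k) ⊗[P] 𝔅.B, ∑ k, ι' k (π k x) = x := fun x => by
    induction x using TensorProduct.induction_on with
    | zero => simp only [map_zero, Finset.sum_const_zero]
    | tmul m b =>
      simp only [π, ι', AlgebraTensorModule.map_tmul, LinearMap.id_apply, LinearMap.coe_proj,
        Function.eval, LinearMap.coe_single]
      rw [← TensorProduct.sum_tmul, Finset.univ_sum_single]
    | add x y hx hy => simp only [map_add, Finset.sum_add_distrib, hx, hy]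
  -- `π_j (ι_k y) = δ_{jk} y`
  have hπι : ∀ (j k : ι) (y : N k ⊗[P] 𝔅.B),
      π j (ι' k y) = if hjk : j = k then hjk ▸ y else 0 := by
    intro j k y
    induction y using TensorProduct.induction_on with
    | zero => simp only [map_zero]; split_ifs with hjk <;> [subst hjk; skip] <;> rfl
    | tmul m b =>
      simp only [π, ι', AlgebraTensorModule.map_tmul, LinearMap.id_apply, LinearMap.coe_proj,
        Function.eval, LinearMap.coe_single]
      split_ifs with hjk
      · subst hjk
        rw [Pi.single_eq_same]
      · rw [Pi.single_eq_of_ne hjk, TensorProduct.zero_tmul]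
    | add x y hx hy =>
      rw [map_add, map_add, hx, hy]
      split_ifs with hjk
      · subst hjk; rfl
      · rw [add_zero]
  have hto : ∀ (x : 𝔅.labelFilD ρ τ i) (k : ι), π k x ∈ 𝔅.labelFilD (ρs k) τ i := fun x k =>
    𝔅.labelFilD_map_left ρ (ρs k) _ (hπ k) τ x.2
  have hinv : ∀ y : ∀ k, 𝔅.labelFilD (ρs k) τ i,
      ∑ k, ι' k (y k : N k ⊗[P] 𝔅.B) ∈ 𝔅.labelFilD ρ τ i := fun y =>
    Submodule.sum_mem _ fun k _ => 𝔅.labelFilD_map_left (ρs k) ρ _ (hι k) τ (y k).2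
  let e : 𝔅.labelFilD ρ τ i ≃ₗ[E] ∀ k, 𝔅.labelFilD (ρs k) τ i :=
    { toFun := fun x k => ⟨π k x, hto x k⟩
      map_add' := fun x y => by
        funext k; apply Subtype.ext
        simp only [Submodule.coe_add, map_add, Pi.add_apply]
      map_smul' := fun c x => by
        funext k; apply Subtype.ext
        simp only [Submodule.coe_smul, map_smul, Pi.smul_apply, RingHom.id_apply]
      invFun := fun y => ⟨∑ k, ι' k (y k : N k ⊗[P] 𝔅.B), hinv y⟩
      left_inv := fun x => by
        apply Subtype.ext
        exact hsum x
      right_inv := fun y => by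
        funext j; apply Subtype.ext
        change π j (∑ k, ι' k (y k : N k ⊗[P] 𝔅.B)) = y j
        rw [map_sum, Finset.sum_eq_single j (fun k _ hkj => by rw [hπι, dif_neg (Ne.symm hkj)])
          (fun hj => absurd (Finset.mem_univ j) hj), hπι, dif_pos rfl] }
  rw [e.finrank_eq, Module.finrank_pi_fintype]

/-- **Labelled Hodge–Tate weights are additive over direct sums:
`HT_τ(Π_k ρ_k) = Σ_k HT_τ(ρ_k)`** (multiset sum) for a representation acting componentwise on
`Π_k V_k`, the label components `D_τ(ρ_k)` being finite-dimensional (`dim gr^i` is additive).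
[cite: FontaineAsterisque223III, Exp. III §1.5.4 and Prop. 1.5.2] [cite: Patrikis2019, §2.3.1] -/
theorem labelledHodgeTateWeights_pi (h : ∀ (σ : Γ) (x : ∀ k, N k) (k : ι), ρ σ x k = ρs k σ (x k))
    (τ : F →+* E) (hfin : ∀ k, FiniteDimensional E (𝔅.labelD (ρs k) τ)) :
    𝔅.labelledHodgeTateWeights ρ τ = ∑ k, 𝔅.labelledHodgeTateWeights (ρs k) τ := by
  haveI : ∀ k j, FiniteDimensional E (𝔅.labelFilD (ρs k) τ j) := fun k j =>
    Submodule.finiteDimensional_of_le (𝔅.labelFilD_le (ρs k) τ j)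
  have hd : (fun i => Module.finrank E (𝔅.labelFilD ρ τ i)) =
      fun i => ∑ k, Module.finrank E (𝔅.labelFilD (ρs k) τ i) := by
    funext i
    exact 𝔅.finrank_labelFilD_pi ρ ρs h τ i hfin
  rw [labelledHodgeTateWeights_def, hd]
  simp only [labelledHodgeTateWeights_def]
  have hanti : ∀ k, Antitone fun i => Module.finrank E (𝔅.labelFilD (ρs k) τ i) := fun k a b hab =>
    Submodule.finrank_mono (𝔅.labelFilD_antitone (ρs k) τ hab)
  refine jumpMultiset_sum Finset.univ (fun k i => Module.finrank E (𝔅.labelFilD (ρs k) τ i))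
    (fun k _ => hanti k) (fun k _ => ?_)
  haveI := hfin k
  exact jumps_finite_of_antitone_of_le (hanti k)
    (fun j => Submodule.finrank_mono (𝔅.labelFilD_le (ρs k) τ j))

end Pi

/-! ### §4 Framed block-diagonal representations -/

section BlockDiagonal

variable {Γ : Type u} [Group Γ] [TopologicalSpace Γ] {P : Type v} {F : Type v'} [Field P]
  [Field F] [Algebra P F]
  {E : Type*} [Field E] [Algebra P E] [TopologicalSpace E] [IsTopologicalRing E]
  (𝔅 : PeriodRingData.{u, v, v', w} Γ P F)

/-- **Labelled Hodge–Tate weights of a block-diagonal framed representation are the sum of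
those of its blocks**: if `T : Γ →ₜ* GL_N(E)` is block diagonal along `e : Fin d × Fin n ≃ Fin N`,
`T(g) = e·diag(S₁(g), …, S_d(g))·e⁻¹` with framed `S_k : Γ →ₜ* GL_n(E)`, and the label components
`D_τ(S_k)` are finite-dimensional, then `HT_τ(T) = Σ_k HT_τ(S_k)` for the period-ring datum `𝔅`
(any `B`; intended `B_dR`). Transport along `E^{Fin d × Fin n} ≃ E^N` to the componentwise
representation, then `labelledHodgeTateWeights_pi`.
[cite: FontaineAsterisque223III, Exp. III §1.5, Prop. 1.5.2] [cite: Patrikis2019, §2.3.1 and Lemma 7.2.1] -/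
theorem labelledHodgeTateWeights_blockDiagonal {d n N : ℕ} (e : Fin d × Fin n ≃ Fin N)
    (T : FramedRep Γ E N) (S : Fin d → FramedRep Γ E n)
    (hT : ∀ g, ((T g : GL (Fin N) E) : Matrix (Fin N) (Fin N) E) =
      Matrix.reindex e e (Matrix.comp (Fin d) (Fin d) (Fin n) (Fin n) E
        (Matrix.diagonal fun k => ((S k g : GL (Fin n) E) : Matrix (Fin n) (Fin n) E))))
    (τ : F →+* E)
    (hfin : ∀ k, FiniteDimensional E (𝔅.labelD (FramedRep.toContinuousRep (S k)) τ)) :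
    𝔅.labelledHodgeTateWeights (FramedRep.toContinuousRep T) τ =
      ∑ k, 𝔅.labelledHodgeTateWeights (FramedRep.toContinuousRep (S k)) τ := by
  classical
  obtain ⟨ρπ, hρπ⟩ :=
    ContinuousRep.exists_pi (fun k : Fin d => FramedRep.toContinuousRep (S k))
  -- the `E`-linear isomorphism `⊕ₖ Eⁿ ≃ E^N`, `w ↦ (j ↦ w (e⁻¹ j).1 (e⁻¹ j).2)`
  let Φ : (Fin d → Fin n → E) ≃ₗ[E] (Fin N → E) :=
    { toFun := fun w j => w (e.symm j).1 (e.symm j).2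
      invFun := fun v k l => v (e (k, l))
      map_add' := fun _ _ => rfl
      map_smul' := fun _ _ => rfl
      left_inv := fun w => by
        funext k l
        simp only [Equiv.symm_apply_apply]
      right_inv := fun v => by
        funext j
        simp only [Prod.mk.eta, Equiv.apply_symm_apply] }
  have hΦ : ∀ (σ : Γ) (w : Fin d → Fin n → E),
      Φ (ρπ σ w) = FramedRep.toContinuousRep T σ (Φ w) := by
    intro σ w
    funext j
    change ρπ σ w (e.symm j).1 (e.symm j).2 = _
    rw [hρπ, FramedRep.toContinuousRep_apply_apply, FramedRep.toContinuousRep_apply_apply, hT,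
      Matrix.mulVec, Matrix.mulVec, dotProduct, dotProduct, ← e.sum_comp]
    change _ = ∑ x : Fin d × Fin n,
      (Matrix.reindex e e _) j (e x) * w (e.symm (e x)).1 (e.symm (e x)).2
    have hsplit : ∀ x : Fin d × Fin n, (Matrix.reindex e e (Matrix.comp (Fin d) (Fin d) (Fin n)
        (Fin n) E (Matrix.diagonal fun k => ((S k σ : GL (Fin n) E) : Matrix (Fin n) (Fin n) E))))
        j (e x) =
        if (e.symm j).1 = x.1 then ((S (e.symm j).1 σ : GL (Fin n) E) : Matrix (Fin n) (Fin n) E)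
          (e.symm j).2 x.2 else 0 := fun x => by
      rw [Matrix.reindex_apply, Matrix.submatrix_apply, Equiv.symm_apply_apply, Matrix.comp_apply,
        Matrix.diagonal_apply]
      split_ifs with h
      · rfl
      · rfl
    simp only [hsplit, Fintype.sum_prod_type, Equiv.symm_apply_apply]
    rw [Finset.sum_eq_single (e.symm j).1]
    · simp
    · intro k _ hk
      simp only [if_neg (Ne.symm hk), zero_mul, Finset.sum_const_zero]
    · intro hk
      exact absurd (Finset.mem_univ _) hk
  rw [← 𝔅.labelledHodgeTateWeights_eq_of_equiv ρπ (FramedRep.toContinuousRep T) Φ hΦ τ,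
    𝔅.labelledHodgeTateWeights_pi ρπ (fun k : Fin d => FramedRep.toContinuousRep (S k)) hρπ τ hfin]

end BlockDiagonal

end PeriodRingData

end Literature.NumberTheory.GaloisRepresentations

end
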